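import Summits.NavierStokesRegularity.NavierStokesRegularity.Theorems.BoundedTemperatureClosed.Negative.ZeroDatumTools
import Summits.NavierStokesRegularity.NavierStokesRegularity.Theorems.EulerProximatePump.Negative.DoorObstructions

/-!
# Crux `BoundedTemperatureClosed` (stmt-NavierStokesRegularity-18303), negative side:
# `¬ BoundedTemperatureClosed` modulo the open statement `TypeIInfimumNotAttainedNS`

Negative lemma modulo `H` (refuter, crux disprover cycle 1; `--supports`, nothing here closes the item, no
conclusion asserts a Theses decl positively). It rides on the line lead's landed `ZeroDatumTools.lean` (same
directory): at the ZERO averaging datum the route's segment is `T_θ = θ·B`, membership of `θ ∈ (0,1]` in the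
crux's set at ceiling `M` is Schwartz-data `H¹⁰_df`-mild Type-I blow-up of Navier–Stokes at ceiling `θM`
(`mem_btSet_iff_of_form_eq_zero`), and closedness forces ATTAINMENT of Navier–Stokes Type-I ceilings
(`nsTypeI_of_forall_lt_of_boundedTemperatureClosed`). This file adds:

* `TypeIInfimumNotAttainedNS` — the registered OPEN STATEMENT `H` (CONVENTIONS §4, `@[conjecture] def`, not
  asserted): some ceiling `K > 0` is not a Type-I ceiling of Schwartz-data mild Navier–Stokes blow-ups although
  every `K' > K` is ("the infimal Type-I constant of Navier–Stokes is not attained");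
* `boundedTemperatureClosed_false_of_typeIInfimumNotAttainedNS : TypeIInfimumNotAttainedNS → ¬ BoundedTemperatureClosed`
  — the negative lemma: the crux AS QUANTIFIED (`∀ 𝒜 ∀ M`) is hostage to an open Navier–Stokes attainment
  question foreign to the route's `closes` (which uses the crux only at the Door's datum, only as `θ → 1`, and
  discards the Type-I bound there), supporting the restatement on file (endpoint-only, Type-I-free
  `BoundedTemperatureClosedAtOne`, PumpContinuationRepair.lean on the item; the zero datum does not bite it:
  parameters approach `1` from below and Type-I ceilings form an up-set, `nsTypeI_mono`);
* `btSet_eq_empty_of_nonpos`, `isClosed_btSet_of_nonpos`, `boundedTemperatureClosed_iff_pos` — the cold sector: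
  for `M ≤ 0` the crux's set is empty for EVERY datum (landed `EulerProximatePump.Negative.ceiling_pos_of_tIB`),
  so the crux is equivalent to its restriction to `M > 0` (hypothesis-mutation finding on the ceiling
  quantifier).

## References

* T. Tao, J. Amer. Math. Soc. 29 (2016), arXiv:1402.0290v3, §1.1 (1.13), (1.15), (1.16). [`Tao2016AveragedNS`]
* W. Rusin, V. Šverák, J. Funct. Anal. 260 (2011) 879–891, arXiv:0911.0500, §1 question (Q), Cor. 4.3 (minimal
  blow-up DATA in `Ḣ^{1/2}`: the data-side attainment question, whose Type-I-constant analogue is `H`). [`RusinSverak2011`]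
-/

noncomputable section

-- the nested summit namespace `…NavierStokesRegularity.NavierStokesRegularity…` is the tree's layout
-- (D-0017), so the duplicated-namespace linter must be silenced for every declaration below
set_option linter.dupNamespace false

namespace Summit.NavierStokesRegularity.NavierStokesRegularity.Theorems.BoundedTemperatureClosed.Negative

-- NB: no `open` of any `Summit.…` namespace in this file (an open statement declared here may be relocated
-- into `Literature/` by the gate together with the `open` lines); Summits-side names are namespace-relative.
open MeasureTheory Set Filter Topology
open scoped ENNReal
open Literature.Analysis.FluidPDE Literature.Analysis.FluidPDE.Tao2016

/-- The bounded-temperature blow-up set of the datum `𝒜` at ceiling `M` along the segment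
`T_θ = (1-θ)·B̃_𝒜 + θ·B` — verbatim the set whose closedness the crux asserts (a notation, so that the
statements below are syntactically instances of the crux body). -/
local notation3 "btSet[" 𝒜 ", " M "]" =>
  {θ : ℝ | θ ∈ Set.Icc (0 : ℝ) 1 ∧
    ∃ u₀ : SchwartzMap (EuclideanSpace ℝ (Fin 3)) (EuclideanSpace ℝ (Fin 3)),
      Literature.Analysis.FluidPDE.VectorCalculus.IsDivFree ⇑u₀ ∧ ∃ S : ℝ, 0 < S ∧
      ∃ u : ℝ → Literature.Analysis.FluidPDE.Tao2016.L2C,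
        Literature.Analysis.FluidPDE.Tao2016.IsMildSolutionFor
          (fun a b c => ((1 - θ : ℝ) : ℂ) * AveragingDatum.form 𝒜 a b c +
            ((θ : ℝ) : ℂ) * Literature.Analysis.FluidPDE.Tao2016.eulerForm a b c)
          (Literature.Analysis.FluidPDE.Tao2016.schwartzL2 u₀) (Set.Ico 0 S) u ∧
        (∀ t ∈ Set.Ico 0 S, MeasureTheory.eLpNorm (u t) ⊤ MeasureTheory.volume ≤
          ENNReal.ofReal (M / Real.sqrt (S - t))) ∧
        ¬ ∃ S' : ℝ, S < S' ∧ ∃ v : ℝ → Literature.Analysis.FluidPDE.Tao2016.L2C,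
          Literature.Analysis.FluidPDE.Tao2016.IsMildSolutionFor
            (fun a b c => ((1 - θ : ℝ) : ℂ) * AveragingDatum.form 𝒜 a b c +
              ((θ : ℝ) : ℂ) * Literature.Analysis.FluidPDE.Tao2016.eulerForm a b c)
            (Literature.Analysis.FluidPDE.Tao2016.schwartzL2 u₀) (Set.Ico 0 S') v ∧
          ∀ t ∈ Set.Ico 0 S, v t = u t}

/-! ### Degenerate instance: the cold sector `M ≤ 0` is empty, closedness is free there -/

/-- **Cold sector.** For a ceiling `M ≤ 0` the bounded-temperature blow-up set of ANY datum is empty: the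
Type-I bound forces `u t = 0` in `L²` on `[0,S)`, the mild identity at `t = 0` gives `⟨u₀, w⟩ = 0` for all
`w ∈ H¹⁰_df`, hence `⟨e^{tΔ}u₀, w⟩ = ⟨u₀, e^{tΔ}w⟩ = 0` for all `t`, and `v ≡ 0` is a mild extension to
`[0, S+1)` — contradicting non-extension (the Door disprover's landed `ceiling_pos_of_tIB`,
`Theorems/EulerProximatePump/Negative/DoorObstructions.lean`, run on this crux's own set). So the crux's
`∀ M` is only active for `M > 0`. [folklore] -/
theorem btSet_eq_empty_of_nonpos (𝒜 : AveragingDatum) {M : ℝ} (hM : M ≤ 0) : btSet[𝒜, M] = ∅ := by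
  ext θ
  simp only [mem_empty_iff_false, iff_false]
  rintro ⟨-, h⟩
  exact (EulerProximatePump.Negative.ceiling_pos_of_tIB
    (EulerProximatePump.Negative.seg_zero_left 𝒜 θ) h).not_ge hM

/-- Hence closedness is free in the cold sector: for `M ≤ 0` the crux's set is `∅`. [folklore] -/
theorem isClosed_btSet_of_nonpos (𝒜 : AveragingDatum) {M : ℝ} (hM : M ≤ 0) : IsClosed btSet[𝒜, M] := by
  rw [btSet_eq_empty_of_nonpos 𝒜 hM]
  exact isClosed_empty

/-- **Hypothesis-mutation finding (the ceiling quantifier).** The crux is equivalent to its restriction to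
positive ceilings `M > 0`: the cold sector is empty. Provers may assume `0 < M` for free. [folklore] -/
theorem boundedTemperatureClosed_iff_pos :
    Theses.PumpContinuation.BoundedTemperatureClosed ↔
      ∀ 𝒜 : AveragingDatum, 𝒜.IsSymmetric → 𝒜.HasCancellation → ∀ M : ℝ, 0 < M → IsClosed btSet[𝒜, M] := by
  constructor
  · exact fun h 𝒜 hs hc M _ => h 𝒜 hs hc M
  · intro h 𝒜 hs hc M
    rcases le_or_gt M 0 with hM | hM
    · exact isClosed_btSet_of_nonpos 𝒜 hM
    · exact h 𝒜 hs hc M hM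

/-! ### The open statement `H` -/

/-- OPEN STATEMENT — **the infimal Type-I constant of Navier–Stokes is not attained** (hypothesis `H` of
the negative lemma `boundedTemperatureClosed_false_of_typeIInfimumNotAttainedNS` on crux
stmt-NavierStokesRegularity-18303; a registered open statement in the sense of CONVENTIONS §4, not a named
fact and not asserted): some ceiling `K > 0` carries NO Schwartz-data `H¹⁰_df`-mild solution of the true
Navier–Stokes form `B` (Tao 2016, (1.5), `ν = 1`, mild in the sense of (1.15), `IsMildSolutionFor eulerForm`)
on a time interval `[0,S)` with the Type-I bound `‖u t‖_∞ ≤ K (S-t)^{-1/2}` and no mild extension past `S`,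
although every larger ceiling `K' > K` does. Equivalently: the set of admissible Type-I ceilings of
Schwartz-data mild Navier–Stokes blow-ups is an OPEN ray `(K, ∞)` with `K > 0`. **Why open — neither a proof
nor a disproof is in print.** A proof contains a finite-time blow-up of Navier–Stokes from Schwartz data
(the negation of the Clay regularity statement (A)); a disproof must either exclude Type-I blow-up from
Schwartz data at every ceiling (known only under axisymmetry, Koch–Nadirashvili–Seregin–Šverák 2009) or prove
that the infimal ceiling is attained by a SCHWARTZ datum — the Type-I analogue of Rusin–Šverák's question (Q)
on minimal blow-up data, which they pose and answer only in the scale-invariant space `Ḣ^{1/2}` precisely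
because the minimiser is a weak limit of rescaled data and need not keep any finer (finite-energy, let alone
Schwartz) structure [cite: RusinSverak2011, §1, question (Q) and Cor. 4.3]. Users take
`(h : TypeIInfimumNotAttainedNS)` as an explicit hypothesis. [status: open] [topic Analysis/FluidPDE] -/
@[conjecture] def TypeIInfimumNotAttainedNS : Prop :=
  ∃ K : ℝ, 0 < K ∧
    (¬ ∃ u₀ : SchwartzMap (EuclideanSpace ℝ (Fin 3)) (EuclideanSpace ℝ (Fin 3)),
      Literature.Analysis.FluidPDE.VectorCalculus.IsDivFree ⇑u₀ ∧ ∃ S : ℝ, 0 < S ∧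
      ∃ u : ℝ → Literature.Analysis.FluidPDE.Tao2016.L2C,
        Literature.Analysis.FluidPDE.Tao2016.IsMildSolutionFor Literature.Analysis.FluidPDE.Tao2016.eulerForm
          (Literature.Analysis.FluidPDE.Tao2016.schwartzL2 u₀) (Set.Ico 0 S) u ∧
        (∀ t ∈ Set.Ico 0 S, MeasureTheory.eLpNorm (u t) ⊤ MeasureTheory.volume ≤
          ENNReal.ofReal (K / Real.sqrt (S - t))) ∧
        ¬ ∃ S' : ℝ, S < S' ∧ ∃ v : ℝ → Literature.Analysis.FluidPDE.Tao2016.L2C,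
          Literature.Analysis.FluidPDE.Tao2016.IsMildSolutionFor Literature.Analysis.FluidPDE.Tao2016.eulerForm
            (Literature.Analysis.FluidPDE.Tao2016.schwartzL2 u₀) (Set.Ico 0 S') v ∧
          ∀ t ∈ Set.Ico 0 S, v t = u t) ∧
    ∀ K' : ℝ, K < K' →
      ∃ u₀ : SchwartzMap (EuclideanSpace ℝ (Fin 3)) (EuclideanSpace ℝ (Fin 3)),
        Literature.Analysis.FluidPDE.VectorCalculus.IsDivFree ⇑u₀ ∧ ∃ S : ℝ, 0 < S ∧
        ∃ u : ℝ → Literature.Analysis.FluidPDE.Tao2016.L2C,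
          Literature.Analysis.FluidPDE.Tao2016.IsMildSolutionFor Literature.Analysis.FluidPDE.Tao2016.eulerForm
            (Literature.Analysis.FluidPDE.Tao2016.schwartzL2 u₀) (Set.Ico 0 S) u ∧
          (∀ t ∈ Set.Ico 0 S, MeasureTheory.eLpNorm (u t) ⊤ MeasureTheory.volume ≤
            ENNReal.ofReal (K' / Real.sqrt (S - t))) ∧
          ¬ ∃ S' : ℝ, S < S' ∧ ∃ v : ℝ → Literature.Analysis.FluidPDE.Tao2016.L2C,
            Literature.Analysis.FluidPDE.Tao2016.IsMildSolutionFor Literature.Analysis.FluidPDE.Tao2016.eulerForm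
              (Literature.Analysis.FluidPDE.Tao2016.schwartzL2 u₀) (Set.Ico 0 S') v ∧
            ∀ t ∈ Set.Ico 0 S, v t = u t

/-! ### The negative lemma -/

/-- **Negative lemma: `¬ BoundedTemperatureClosed` modulo `TypeIInfimumNotAttainedNS`.** If some ceiling
`K > 0` is not a Type-I ceiling of Schwartz-data `H¹⁰_df`-mild Navier–Stokes blow-ups although every `K' > K`
is, the crux fails — witnessed at the zero averaging datum and the ceiling `2K`, where the crux's blow-up set
meets `(0,1]` in the half-open ray `(1/2, 1]` (the line lead's landed
`nsTypeI_of_forall_lt_of_boundedTemperatureClosed`, contraposed). [folklore] -/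
theorem boundedTemperatureClosed_false_of_typeIInfimumNotAttainedNS (hH : TypeIInfimumNotAttainedNS) :
    ¬ Theses.PumpContinuation.BoundedTemperatureClosed := fun h => by
  obtain ⟨K, hK, hnot, hall⟩ := hH
  exact hnot (nsTypeI_of_forall_lt_of_boundedTemperatureClosed h hK hall)

end Summit.NavierStokesRegularity.NavierStokesRegularity.Theorems.BoundedTemperatureClosed.Negative

end
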